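import Literature.Topology.FourManifolds.BoundaryOrientation
import Literature.Topology.FourManifolds.ConnectedSum
import Literature.Topology.FourManifolds.RegularDomainMaps
import HarnessLib

/-!
# The boundary of an open submanifold: inclusion, identity differential, orientations

Topic `Literature/Topology/FourManifolds` (fact seat
`provefact-Literature.Topology.FourManifolds.IsHandlebody.exists_diffeomorph_isBoundaryGluing_sphere`,
step F2b₁ of the Lickorish–Wallace DAG; orientation bookkeeping of the level-preserving
handle-extension step to which L1 `oneHandle_nonempty_diffeomorph` is reduced: orientation
characters computed in the piece of a level lying in a handle chart are transferred to the whole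
level along the inclusion of the boundary of an open submanifold).  Everything here is
**proved**; no named facts.

For an open subset `U` of a manifold with boundary `W` (model `𝓡∂ (n + 1)`; `U` with Mathlib's
open-submanifold structure, `TopologicalSpace.Opens`), the boundary of `U` consists of the
boundary points of `W` lying in `U` (Mathlib's `isBoundaryPoint_iff_isBoundaryPoint_val`), and
with the boundary structures `BoundaryManifold.chartedSpace` (`Cobordism.lean`; charts
`tail ∘ chartAt ∘ val`) the inclusion `∂U → ∂W`
(`Literature.Topology.FourManifolds.Opens.boundaryIncl`) reads as the identity in the preferred
charts — the chart of `U` at `x` *is* the chart of `W` at `↑x` restricted — so it has **identity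
differential** (`hasMFDerivAt_boundaryIncl`, the boundary twin of the tree's
`hasMFDerivAt_subtype_val`, `OrientedConnectedSumSphereSelf.lean`), Jacobian determinant `1`, is
smooth, and **preserves the boundary orientations** `(o.restrict U).boundary`, `o.boundary`
(`isOrientationPreserving_boundaryIncl`; `SmoothOrientation.restrict`, `ConnectedSum.lean`, and
`SmoothOrientation.boundary`, `BoundaryOrientation.lean`).  Lee, *Introduction to Smooth
Manifolds* (2013), Example 1.26, Prop. 3.9 (`T_pU = T_pM`), Thm. 5.11 (boundary charts).

## References

* J. M. Lee, *Introduction to Smooth Manifolds*, 2nd ed., GTM 218 (2013), Example 1.26,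
  Prop. 3.9, Thm. 5.11, Prop. 15.24. [LeeSmoothManifolds2013]
* M. W. Hirsch, *Differential Topology*, GTM 33 (1976), Ch. 4 §4, p. 103. [HirschDT1976]
-/

open scoped Manifold ContDiff Topology
open Set Function Module Filter

noncomputable section

namespace Literature.Topology.FourManifolds

universe u

/-- Local notation: `𝔼 n` is the model Euclidean space `EuclideanSpace ℝ (Fin n)`. -/
local notation "𝔼 " n:arg => EuclideanSpace ℝ (Fin n)
/-- Local notation: `ℍ n` is the model half-space `EuclideanHalfSpace n`. -/
local notation "ℍ " n:arg => EuclideanHalfSpace n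

namespace Opens

variable {n : ℕ} {W : Type u} [TopologicalSpace W] [ChartedSpace (ℍ (n + 1)) W]
  (U : TopologicalSpace.Opens W)

/-- **The inclusion of the boundary of an open submanifold into the boundary**, `∂U → ∂W`.
[cite: LeeSmoothManifolds2013, Prop. 3.9] -/
def boundaryIncl (z : ↥((𝓡∂ (n + 1)).boundary (U : Type u))) : ↥((𝓡∂ (n + 1)).boundary W) :=
  ⟨z.1.1, (𝓡∂ (n + 1)).isBoundaryPoint_iff_isBoundaryPoint_val.1 z.2⟩

/-- The underlying point (definitional). [folklore] -/
@[simp] theorem boundaryIncl_coe (z : ↥((𝓡∂ (n + 1)).boundary (U : Type u))) :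
    ((boundaryIncl U z : ↥((𝓡∂ (n + 1)).boundary W)) : W) = z.1.1 := rfl

/-- The inclusion is injective. [folklore] -/
theorem injective_boundaryIncl : Injective (boundaryIncl (n := n) U) := by
  intro z z' h
  have : z.1.1 = z'.1.1 := congrArg (fun v : ↥((𝓡∂ (n + 1)).boundary W) => (v : W)) h
  exact Subtype.ext (Subtype.ext this)

/-- The inclusion is continuous. [folklore] -/
theorem continuous_boundaryIncl : Continuous (boundaryIncl (n := n) U) :=
  Continuous.subtype_mk (continuous_subtype_val.comp continuous_subtype_val) _

/-- Boundary points of `W` in `U` are in the image. [folklore] -/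
theorem range_boundaryIncl :
    range (boundaryIncl (n := n) U) = {v : ↥((𝓡∂ (n + 1)).boundary W) | (v : W) ∈ U} := by
  ext v
  constructor
  · rintro ⟨z, rfl⟩; exact z.1.2
  · intro hv
    refine ⟨⟨⟨v.1, hv⟩, ?_⟩, rfl⟩
    exact (𝓡∂ (n + 1)).isBoundaryPoint_iff_isBoundaryPoint_val.2 v.2

variable [IsManifold (𝓡∂ (n + 1)) ∞ W]

/-- **The boundary inclusion of an open submanifold has identity differential**: in the
preferred boundary charts (`tail ∘ chartAt ∘ val`, the chart of `U` at `x` being the chart of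
`W` at `↑x` restricted) it reads as the identity near the base point. Lee (2013), Prop. 3.9,
Thm. 5.11. [cite: LeeSmoothManifolds2013, Prop. 3.9] -/
theorem hasMFDerivAt_boundaryIncl (z : ↥((𝓡∂ (n + 1)).boundary (U : Type u))) :
    HasMFDerivAt (𝓡 n) (𝓡 n) (boundaryIncl U) z (ContinuousLinearMap.id ℝ (𝔼 n)) := by
  refine ⟨(continuous_boundaryIncl U).continuousAt, ?_⟩
  haveI : Nonempty U := ⟨z.1⟩
  set x : U := z.1 with hx
  set e := chartAt (ℍ (n + 1)) (x : W) with he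
  -- the chart of `U` at `x` is `e` restricted
  have hchart : chartAt (ℍ (n + 1)) x = e.subtypeRestr ⟨x⟩ := rfl
  -- the written map is the identity on the target of the boundary chart of `U` at `z`
  have hpt : extChartAt (𝓡 n) z z = BoundaryManifold.boundaryChart z z := by
    rw [BoundaryManifold.extChartAt_coe]
  have htgt : (BoundaryManifold.boundaryChart z).target ∈ 𝓝 (extChartAt (𝓡 n) z z) := by
    rw [hpt]
    exact (BoundaryManifold.boundaryChart z).open_target.mem_nhds
      ((BoundaryManifold.boundaryChart z).map_source (by
        rw [BoundaryManifold.boundaryChart_source]; exact mem_chart_source (ℍ (n + 1)) z.1))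
  have heq : writtenInExtChartAt (𝓡 n) (𝓡 n) z (boundaryIncl U) =ᶠ[𝓝[range (𝓡 n)] (extChartAt (𝓡 n) z z)] id := by
    refine Filter.eventuallyEq_of_mem (mem_nhdsWithin_of_mem_nhds htgt) fun u hu => ?_
    have hu' : BoundaryManifold.toHalfSpace n u ∈ (chartAt (ℍ (n + 1)) x).target := hu
    simp only [writtenInExtChartAt, comp_apply, id_eq, BoundaryManifold.extChartAt_coe,
      BoundaryManifold.extChartAt_symm_coe, BoundaryManifold.boundaryChart_apply]
    -- the point of `∂U` with coordinate `u`
    have h1 : ((BoundaryManifold.boundaryChart z).symm u).1 = (chartAt (ℍ (n + 1)) x).symm (BoundaryManifold.toHalfSpace n u) :=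
      BoundaryManifold.coe_boundaryChart_symm_of_mem z hu'
    have h2 : (((chartAt (ℍ (n + 1)) x).symm (BoundaryManifold.toHalfSpace n u) : U) : W) =
        e.symm (BoundaryManifold.toHalfSpace n u) := by
      rw [hchart]; exact e.subtypeRestr_symm_apply ⟨x⟩ (by rw [← hchart]; exact hu')
    have h3 : BoundaryManifold.toHalfSpace n u ∈ e.target := by
      have := e.subtypeRestr_target_subset ⟨x⟩ (by rw [← hchart]; exact hu')
      exact this
    rw [show ((boundaryIncl U ((BoundaryManifold.boundaryChart z).symm u) : ↥((𝓡∂ (n + 1)).boundary W)) : W) =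
      ((BoundaryManifold.boundaryChart z).symm u).1.1 from rfl, h1, h2]
    show BoundaryManifold.tail n (e (e.symm (BoundaryManifold.toHalfSpace n u))).val = u
    rw [e.right_inv h3, BoundaryManifold.toHalfSpace_val, BoundaryManifold.tail_consCLE]
  refine (hasFDerivWithinAt_id _ _).congr_of_eventuallyEq heq ?_
  simp only [writtenInExtChartAt, comp_apply, id_eq, extChartAt_to_inv]
  rfl

/-- The differential of the boundary inclusion is the identity. [folklore] -/
theorem mfderiv_boundaryIncl (z : ↥((𝓡∂ (n + 1)).boundary (U : Type u))) :
    mfderiv (𝓡 n) (𝓡 n) (boundaryIncl U) z = ContinuousLinearMap.id ℝ (𝔼 n) :=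
  (hasMFDerivAt_boundaryIncl U z).mfderiv

/-- The boundary inclusion is differentiable. [folklore] -/
theorem mdifferentiable_boundaryIncl : MDifferentiable (𝓡 n) (𝓡 n) (boundaryIncl (n := n) U) :=
  fun z => (hasMFDerivAt_boundaryIncl U z).mdifferentiableAt

/-- **The Jacobian determinant of the boundary inclusion is `1`.** [folklore] -/
theorem det_mfderiv_boundaryIncl (z : ↥((𝓡∂ (n + 1)).boundary (U : Type u))) :
    LinearMap.det (M := 𝔼 n) (mfderiv (𝓡 n) (𝓡 n) (boundaryIncl U) z).toLinearMap = 1 := by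
  rw [mfderiv_boundaryIncl, ContinuousLinearMap.coe_id]
  exact LinearMap.det_id

/-- The Jacobian determinant of the boundary inclusion does not vanish. [folklore] -/
theorem det_mfderiv_boundaryIncl_ne_zero (z : ↥((𝓡∂ (n + 1)).boundary (U : Type u))) :
    LinearMap.det (M := 𝔼 n) (mfderiv (𝓡 n) (𝓡 n) (boundaryIncl U) z).toLinearMap ≠ 0 := by
  rw [det_mfderiv_boundaryIncl]; exact one_ne_zero

/-- **The boundary inclusion is smooth** (the smooth inclusion `∂U → U → W` lands in `∂W`;
Lee 2013, Cor. 5.30). [cite: LeeSmoothManifolds2013, Cor. 5.30] -/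
theorem contMDiff_boundaryIncl : ContMDiff (𝓡 n) (𝓡 n) ∞ (boundaryIncl (n := n) U) := by
  intro z
  have h1 : ContMDiffAt (𝓡 n) (𝓡∂ (n + 1)) ∞ (fun z : ↥((𝓡∂ (n + 1)).boundary (U : Type u)) => (z.1 : W)) z :=
    (contMDiff_subtype_val.comp (BoundaryManifold.isSmoothEmbedding_subtype_val (W := (U : Type u))).contMDiff) z
  exact BoundaryManifold.contMDiffAt_codRestrict
    (g := fun z : ↥((𝓡∂ (n + 1)).boundary (U : Type u)) => (z.1 : W))
    (fun z => (boundaryIncl U z).2) h1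

/-- **The boundary inclusion preserves the boundary orientations** `(o|_U).boundary`,
`o.boundary`: at every point the two orientations are literally the same transfer of `o ↑z`, and
the Jacobian is `1 > 0`. Hirsch (1976), §4.4, p. 103. [cite: HirschDT1976, §4.4 p. 103] -/
theorem isOrientationPreserving_boundaryIncl (o : SmoothOrientation (𝓡∂ (n + 1)) W) :
    IsOrientationPreserving (o.restrict U).boundary o.boundary (boundaryIncl (n := n) U) := by
  intro z
  refine iff_of_true ?_ ?_
  · rw [SmoothOrientation.boundary_apply, SmoothOrientation.boundary_apply, SmoothOrientation.restrict_apply]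
    rfl
  · rw [det_mfderiv_boundaryIncl]; exact one_pos

end Opens

end Literature.Topology.FourManifolds

end
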